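import Mathlib.MeasureTheory.Constructions.HaarToSphere
import Mathlib.MeasureTheory.Measure.Haar.InnerProductSpace
import Mathlib.MeasureTheory.Measure.Lebesgue.VolumeOfBalls
import Mathlib.Analysis.SpecialFunctions.Integrals.Basic
import Literature.MeasureTheory.Hausdorff.ConeVolume
import HarnessLib

/-!
# Volumes of right circular cones in every dimension, and the solid sector over a spherical cap

Generalisation of `ConeVolume.lean` (written for dimension `3`) to a real inner product space `E`
of arbitrary dimension `d + 1`, as support for the identification of the `d`-dimensional Euclidean
Hausdorff measure of the round sphere `S^d` with the polar surface measure in *every* dimension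
(`SphereAreaGeneral.lean`: `μHE[d] (S^d) = volume.toSphere S^d = 2 π^{(d+1)/2} / Γ((d+1)/2)`),
itself needed for Stone's values of the Colding–Minicozzi entropy of spheres and cylinders
(`Literature.Geometry.Riemannian.Stone1994_cylinderEntropy`).

For an orthonormal basis `b` of `E` indexed by `Fin (d + 1)` the right circular cone with apex `0`,
axis `b 0`, height `H` and slope `t` is the set
`{x | 0 < ⟪b 0, x⟫ < H, ‖x‖² - ⟪b 0, x⟫² < t² ⟪b 0, x⟫²}`; in the adapted coordinates
`x ↦ (⟪b 0, x⟫, (⟪b 1, x⟫, …, ⟪b d, x⟫)) ∈ ℝ × ℝ^d` (measure preserving) it is a product-measurable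
set whose slices are Euclidean `d`-balls of radius `t z`, so by Cavalieri
`vol (cone) = ω_d t^d H^{d+1} / (d+1)` with `ω_d = π^{d/2} / Γ(d/2 + 1)` the volume of the unit
`d`-ball (`volume_cone_general`). The solid sector `(0,1) • cap (b 0) c` over the cap of height
`c ∈ (0,1)` is squeezed between the cones of slope `√(1 - c²)/c` and heights `c` and `1`
(`cone_subset_Ioo_smul_cap_general`, `Ioo_smul_cap_subset_cone_general`), whence
`ω_d ρ^d c / (d+1) ≤ vol ((0,1) • cap) ≤ ω_d ρ^d / ((d+1) c^d)`, `ρ = √(1 - c²)`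
(`le_volume_Ioo_smul_cap_general`, `volume_Ioo_smul_cap_le_general`).

No definitions are introduced (the cone is written as a set-builder expression throughout).

## References

* H. Federer, *Geometric measure theory* (1969), 2.10.11, 3.2.13 (classical volumes).
* P. Mattila, *Geometry of sets and measures in Euclidean spaces* (1995), §3–4.
-/

noncomputable section

open Set Metric Module Submodule Filter
open _root_.MeasureTheory _root_.MeasureTheory.Measure
open scoped ENNReal NNReal Topology RealInnerProductSpace Pointwise

namespace Literature.MeasureTheory.Hausdorff

/-! ### Volumes of right circular cones in coordinates -/

/-- The Euclidean ball written in sup-norm coordinates, `{w : Fin d → ℝ | Σ wᵢ² < R²}`, has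
Lebesgue measure `R^d ω_d`, `ω_d = π^{d/2}/Γ(d/2+1)` (Mathlib's `EuclideanSpace.volume_ball`
transported along `toLp`). [folklore] -/
theorem volume_setOf_sum_sq_lt {d : ℕ} (hd : 0 < d) {R : ℝ} (hR : 0 ≤ R) :
    volume {w : Fin d → ℝ | ∑ i, w i ^ 2 < R ^ 2} =
      ENNReal.ofReal R ^ d *
        ENNReal.ofReal (Real.sqrt Real.pi ^ d / Real.Gamma ((d : ℝ) / 2 + 1)) := by
  haveI : Nonempty (Fin d) := ⟨⟨0, hd⟩⟩
  have hmp := PiLp.volume_preserving_toLp (Fin d)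
  have hset : {w : Fin d → ℝ | ∑ i, w i ^ 2 < R ^ 2} =
      (WithLp.toLp 2) ⁻¹' ball (0 : EuclideanSpace ℝ (Fin d)) R := by
    ext w
    simp [EuclideanSpace.ball_zero_eq R hR]
  rw [hset, hmp.measure_preimage measurableSet_ball.nullMeasurableSet,
    EuclideanSpace.volume_ball, Fintype.card_fin]

/-- The cone `{(z, w) | 0 < z < H, Σ wᵢ² < t² z²}` in `ℝ × ℝ^d` is measurable. [folklore] -/
theorem measurableSet_cone_prod_general (d : ℕ) (H t : ℝ) :
    MeasurableSet {p : ℝ × (Fin d → ℝ) | 0 < p.1 ∧ p.1 < H ∧ ∑ i, p.2 i ^ 2 < t ^ 2 * p.1 ^ 2} := by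
  have hS' : {p : ℝ × (Fin d → ℝ) | 0 < p.1 ∧ p.1 < H ∧ ∑ i, p.2 i ^ 2 < t ^ 2 * p.1 ^ 2} =
      {p : ℝ × (Fin d → ℝ) | 0 < p.1} ∩ ({p : ℝ × (Fin d → ℝ) | p.1 < H} ∩
        {p : ℝ × (Fin d → ℝ) | ∑ i, p.2 i ^ 2 < t ^ 2 * p.1 ^ 2}) := rfl
  have h1 : Measurable fun p : ℝ × (Fin d → ℝ) ↦ ∑ i, p.2 i ^ 2 := by fun_prop
  have h2 : Measurable fun p : ℝ × (Fin d → ℝ) ↦ t ^ 2 * p.1 ^ 2 := by fun_prop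
  rw [hS']
  exact (measurableSet_lt measurable_const measurable_fst).inter
    ((measurableSet_lt measurable_fst measurable_const).inter (measurableSet_lt h1 h2))

/-- **Cavalieri for the right circular cone** `{(z, w) | 0 < z < H, Σ wᵢ² < t² z²}` in
`ℝ × ℝ^d` (`d ≥ 1`): its volume is `ω_d t^d H^{d+1} / (d+1)`, the slices being `d`-balls of
radius `t z`. [folklore] -/
theorem volume_cone_prod_general {d : ℕ} (hd : 0 < d) {H t : ℝ} (hH : 0 ≤ H) (ht : 0 ≤ t) :
    volume {p : ℝ × (Fin d → ℝ) | 0 < p.1 ∧ p.1 < H ∧ ∑ i, p.2 i ^ 2 < t ^ 2 * p.1 ^ 2} =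
      ENNReal.ofReal (Real.sqrt Real.pi ^ d / Real.Gamma ((d : ℝ) / 2 + 1) * t ^ d *
        H ^ (d + 1) / (d + 1)) := by
  set C : ℝ := Real.sqrt Real.pi ^ d / Real.Gamma ((d : ℝ) / 2 + 1) with hC_def
  have hC0 : 0 ≤ C := by
    rw [hC_def]
    have hd' : (0 : ℝ) < (d : ℝ) / 2 + 1 := by
      have := Nat.cast_nonneg (α := ℝ) d
      linarith
    exact div_nonneg (pow_nonneg (Real.sqrt_nonneg _) _) (Real.Gamma_pos_of_pos hd').le
  set S := {p : ℝ × (Fin d → ℝ) | 0 < p.1 ∧ p.1 < H ∧ ∑ i, p.2 i ^ 2 < t ^ 2 * p.1 ^ 2}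
  have hS : MeasurableSet S := measurableSet_cone_prod_general d H t
  rw [show (volume : Measure (ℝ × (Fin d → ℝ))) = volume.prod volume from rfl,
    Measure.prod_apply hS]
  have hslice : ∀ z : ℝ, volume (Prod.mk z ⁻¹' S) =
      (Ioo 0 H).indicator (fun z ↦ ENNReal.ofReal (C * (t * z) ^ d)) z := by
    intro z
    by_cases hz : z ∈ Ioo 0 H
    · rw [indicator_of_mem hz]
      have : Prod.mk z ⁻¹' S = {w : Fin d → ℝ | ∑ i, w i ^ 2 < (t * z) ^ 2} := by
        ext w
        simp [S, hz.1, hz.2, mul_pow]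
      rw [this, volume_setOf_sum_sq_lt hd (mul_nonneg ht hz.1.le), ← hC_def,
        ← ENNReal.ofReal_pow (mul_nonneg ht hz.1.le),
        ← ENNReal.ofReal_mul (pow_nonneg (mul_nonneg ht hz.1.le) _), mul_comm]
    · rw [indicator_of_notMem hz]
      have : Prod.mk z ⁻¹' S = ∅ := by
        ext w
        simp only [S, mem_preimage, mem_setOf_eq, mem_empty_iff_false, iff_false, not_and]
        intro h1 h2
        exact absurd ⟨h1, h2⟩ hz
      rw [this, measure_empty]
  simp_rw [hslice]
  rw [lintegral_indicator measurableSet_Ioo]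
  have hint : IntegrableOn (fun z ↦ C * (t * z) ^ d) (Ioo 0 H) volume :=
    (Continuous.integrableOn_Icc (by fun_prop)).mono_set Ioo_subset_Icc_self
  rw [← ofReal_integral_eq_lintegral_ofReal hint ?_]
  · congr 1
    rw [← integral_Ioc_eq_integral_Ioo, ← intervalIntegral.integral_of_le hH,
      intervalIntegral.integral_const_mul]
    simp_rw [mul_pow]
    rw [intervalIntegral.integral_const_mul, integral_pow]
    simp only [ne_eq, Nat.add_eq_zero_iff, one_ne_zero, and_false, not_false_eq_true, zero_pow,
      sub_zero]
    ring
  · filter_upwards [ae_restrict_mem measurableSet_Ioo] with z hz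
    exact mul_nonneg hC0 (pow_nonneg (mul_nonneg ht hz.1.le) _)

/-! ### Right circular cones in an inner product space -/

variable {E : Type*} [NormedAddCommGroup E] [InnerProductSpace ℝ E]

/-- Parseval split off the first coordinate: `‖x‖² = ⟪b 0, x⟫² + Σ_{j} ⟪b (j+1), x⟫²` for an
orthonormal basis indexed by `Fin (d+1)`. [folklore] -/
theorem norm_sq_eq_inner_sq_add_sum {d : ℕ} (b : OrthonormalBasis (Fin (d + 1)) ℝ E) (x : E) :
    ‖x‖ ^ 2 = ⟪b 0, x⟫ ^ 2 + ∑ j : Fin d, ⟪b j.succ, x⟫ ^ 2 := by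
  rw [← b.repr.norm_map x, EuclideanSpace.norm_sq_eq, Fin.sum_univ_succ]
  simp [OrthonormalBasis.repr_apply_apply, sq_abs]

/-- The cone in adapted coordinates `x ↦ (⟪b 0, x⟫, (⟪b (j+1), x⟫)ⱼ)`. [folklore] -/
theorem cone_eq_preimage_general {d : ℕ} (b : OrthonormalBasis (Fin (d + 1)) ℝ E) (H t : ℝ) :
    {x : E | 0 < ⟪b 0, x⟫ ∧ ⟪b 0, x⟫ < H ∧ ‖x‖ ^ 2 - ⟪b 0, x⟫ ^ 2 < t ^ 2 * ⟪b 0, x⟫ ^ 2} =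
      (fun x ↦ MeasurableEquiv.piFinSuccAbove (fun _ ↦ ℝ) 0 (WithLp.ofLp (b.repr x))) ⁻¹'
        {p : ℝ × (Fin d → ℝ) | 0 < p.1 ∧ p.1 < H ∧ ∑ i, p.2 i ^ 2 < t ^ 2 * p.1 ^ 2} := by
  ext x
  have h1 : (MeasurableEquiv.piFinSuccAbove (fun _ ↦ ℝ) 0 (WithLp.ofLp (b.repr x))).1 = ⟪b 0, x⟫ := by
    simp [OrthonormalBasis.repr_apply_apply]
  have h2 : ∀ j : Fin d,
      (MeasurableEquiv.piFinSuccAbove (fun _ ↦ ℝ) 0 (WithLp.ofLp (b.repr x))).2 j = ⟪b j.succ, x⟫ := by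
    intro j
    simp [Fin.tail, OrthonormalBasis.repr_apply_apply]
  simp only [mem_setOf_eq, mem_preimage, h1, h2, norm_sq_eq_inner_sq_add_sum b x]
  constructor
  · rintro ⟨h1, h2, h3⟩; exact ⟨h1, h2, by linarith⟩
  · rintro ⟨h1, h2, h3⟩; exact ⟨h1, h2, by linarith⟩

variable [FiniteDimensional ℝ E] [MeasurableSpace E] [BorelSpace E]

/-- The adapted coordinates are measure preserving (orthonormal change of basis,
`EuclideanSpace ≃ (Fin (d+1) → ℝ)`, and `Fin.insertNth`-splitting). [folklore] -/
theorem measurePreserving_coneCoord_general {d : ℕ} (b : OrthonormalBasis (Fin (d + 1)) ℝ E) :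
    MeasurePreserving (fun x ↦ MeasurableEquiv.piFinSuccAbove (fun _ ↦ ℝ) 0 (WithLp.ofLp (b.repr x)))
      volume volume :=
  ((volume_preserving_piFinSuccAbove (fun _ : Fin (d + 1) ↦ ℝ) 0).comp
    (PiLp.volume_preserving_ofLp (Fin (d + 1)))).comp b.measurePreserving_repr

/-- **Volume of a right circular cone in dimension `d + 1`** (`d ≥ 1`) of height `H` and slope
`t`, apex `0`, axis `b 0`: `ω_d t^d H^{d+1} / (d+1)`. [folklore] -/
theorem volume_cone_general {d : ℕ} (hd : 0 < d) (b : OrthonormalBasis (Fin (d + 1)) ℝ E)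
    {H t : ℝ} (hH : 0 ≤ H) (ht : 0 ≤ t) :
    volume {x : E | 0 < ⟪b 0, x⟫ ∧ ⟪b 0, x⟫ < H ∧ ‖x‖ ^ 2 - ⟪b 0, x⟫ ^ 2 < t ^ 2 * ⟪b 0, x⟫ ^ 2} =
      ENNReal.ofReal (Real.sqrt Real.pi ^ d / Real.Gamma ((d : ℝ) / 2 + 1) * t ^ d *
        H ^ (d + 1) / (d + 1)) := by
  rw [cone_eq_preimage_general, (measurePreserving_coneCoord_general b).measure_preimage
    (measurableSet_cone_prod_general d H t).nullMeasurableSet, volume_cone_prod_general hd hH ht]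

/-! ### Cones over spherical caps -/

omit [FiniteDimensional ℝ E] [MeasurableSpace E] [BorelSpace E] in
/-- The cone over the cap of height `c` (`0 < c < 1`) lies in the right cone of height `1` and
slope `√(1 - c²)/c` (any dimension). [folklore] -/
theorem Ioo_smul_cap_subset_cone_general {d : ℕ} (b : OrthonormalBasis (Fin (d + 1)) ℝ E) {c : ℝ}
    (hc0 : 0 < c) (hc1 : c < 1) :
    Ioo (0 : ℝ) 1 • cap (b 0) c ⊆
      {x : E | 0 < ⟪b 0, x⟫ ∧ ⟪b 0, x⟫ < 1 ∧
        ‖x‖ ^ 2 - ⟪b 0, x⟫ ^ 2 < (Real.sqrt (1 - c ^ 2) / c) ^ 2 * ⟪b 0, x⟫ ^ 2} := by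
  intro x hx
  rw [mem_Ioo_smul_iff_of_subset_sphere (cap_subset_sphere _ _)] at hx
  obtain ⟨h0, h1, -, hc⟩ := hx
  rw [inner_smul_right, lt_inv_mul_iff₀ h0] at hc
  have hz0 : 0 < ⟪b 0, x⟫ := lt_of_le_of_lt (by positivity) hc
  have hz1 : ⟪b 0, x⟫ < 1 := by
    have := real_inner_le_norm (b 0) x
    rw [b.orthonormal.1, one_mul] at this
    linarith
  refine ⟨hz0, hz1, ?_⟩
  have ht2 : (Real.sqrt (1 - c ^ 2) / c) ^ 2 = (1 - c ^ 2) / c ^ 2 := by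
    rw [div_pow, Real.sq_sqrt (by nlinarith)]
  rw [ht2]
  have hsq : c ^ 2 * ‖x‖ ^ 2 < ⟪b 0, x⟫ ^ 2 := by
    have := mul_self_lt_mul_self (by positivity) hc
    nlinarith
  have hc2 : 0 < c ^ 2 := by positivity
  rw [div_mul_eq_mul_div, lt_div_iff₀ hc2]
  nlinarith

omit [FiniteDimensional ℝ E] [MeasurableSpace E] [BorelSpace E] in
/-- The right cone of height `c` and slope `√(1 - c²)/c` lies in the cone over the cap of height
`c` (`0 < c < 1`; any dimension). [folklore] -/
theorem cone_subset_Ioo_smul_cap_general {d : ℕ} (b : OrthonormalBasis (Fin (d + 1)) ℝ E) {c : ℝ}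
    (hc0 : 0 < c) (hc1 : c < 1) :
    {x : E | 0 < ⟪b 0, x⟫ ∧ ⟪b 0, x⟫ < c ∧
        ‖x‖ ^ 2 - ⟪b 0, x⟫ ^ 2 < (Real.sqrt (1 - c ^ 2) / c) ^ 2 * ⟪b 0, x⟫ ^ 2} ⊆
      Ioo (0 : ℝ) 1 • cap (b 0) c := by
  intro x hx
  obtain ⟨hz0, hzc, hq⟩ := hx
  have ht2 : (Real.sqrt (1 - c ^ 2) / c) ^ 2 = (1 - c ^ 2) / c ^ 2 := by
    rw [div_pow, Real.sq_sqrt (by nlinarith)]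
  rw [ht2] at hq
  have hc2 : 0 < c ^ 2 := by positivity
  rw [div_mul_eq_mul_div, lt_div_iff₀ hc2] at hq
  have hzx : ⟪b 0, x⟫ ≤ ‖x‖ := by
    have := real_inner_le_norm (b 0) x
    rwa [b.orthonormal.1, one_mul] at this
  have hx0 : 0 < ‖x‖ := hz0.trans_le hzx
  have hz2 : ⟪b 0, x⟫ ^ 2 < c ^ 2 := by nlinarith
  have hcx : c ^ 2 * ‖x‖ ^ 2 < c ^ 2 * 1 := by nlinarith
  have hx1 : ‖x‖ < 1 := by
    have h' : ‖x‖ ^ 2 < 1 := lt_of_mul_lt_mul_left hcx hc2.le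
    by_contra h2
    push Not at h2
    nlinarith
  rw [mem_Ioo_smul_iff_of_subset_sphere (cap_subset_sphere _ _)]
  refine ⟨hx0, hx1, ?_, ?_⟩
  · rw [norm_smul, norm_inv, norm_norm, inv_mul_cancel₀ hx0.ne']
  · rw [inner_smul_right, lt_inv_mul_iff₀ hx0]
    by_contra h
    push Not at h
    have := mul_self_le_mul_self hz0.le h
    nlinarith

/-- **The solid sector over a cap lies in a right cone**: for `0 < c < 1` and `d ≥ 1`,
`vol ((0,1) • cap (b 0) c) ≤ ω_d (√(1-c²)/c)^d / (d+1)`. [folklore] -/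
theorem volume_Ioo_smul_cap_le_general {d : ℕ} (hd : 0 < d)
    (b : OrthonormalBasis (Fin (d + 1)) ℝ E) {c : ℝ} (hc0 : 0 < c) (hc1 : c < 1) :
    volume (Ioo (0 : ℝ) 1 • cap (b 0) c) ≤
      ENNReal.ofReal (Real.sqrt Real.pi ^ d / Real.Gamma ((d : ℝ) / 2 + 1) *
        (Real.sqrt (1 - c ^ 2) / c) ^ d / (d + 1)) := by
  refine (measure_mono (Ioo_smul_cap_subset_cone_general b hc0 hc1)).trans ?_
  rw [volume_cone_general hd b zero_le_one (by positivity), one_pow, mul_one]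

/-- **The solid sector over a cap contains a right cone**: for `0 < c < 1` and `d ≥ 1`,
`ω_d (√(1-c²)/c)^d c^{d+1} / (d+1) ≤ vol ((0,1) • cap (b 0) c)`. [folklore] -/
theorem le_volume_Ioo_smul_cap_general {d : ℕ} (hd : 0 < d)
    (b : OrthonormalBasis (Fin (d + 1)) ℝ E) {c : ℝ} (hc0 : 0 < c) (hc1 : c < 1) :
    ENNReal.ofReal (Real.sqrt Real.pi ^ d / Real.Gamma ((d : ℝ) / 2 + 1) *
        (Real.sqrt (1 - c ^ 2) / c) ^ d * c ^ (d + 1) / (d + 1)) ≤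
      volume (Ioo (0 : ℝ) 1 • cap (b 0) c) := by
  refine le_trans ?_ (measure_mono (cone_subset_Ioo_smul_cap_general b hc0 hc1))
  rw [volume_cone_general hd b hc0.le (by positivity)]

end Literature.MeasureTheory.Hausdorff

end
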